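import Literature.AlgebraicGeometry.CossartJannsenSaito2020.BlowupTowerLocalizeTransfer
import Literature.RingTheory.HilbertSamuel.ProjDirectrixLiftsTransport
import HarnessLib

/-!
# CJS LNM 2270, Def. 6.34 (i) / Def. 6.38 (ii) read on the LOCALISED tower: `ℙ(Dir_x(X)) ⊂ Bℓ_x(X)` is transported
# along morphisms inducing isomorphisms of local rings — PROOFS (companion of `BlowupTowerLocalize.lean`,
# `BlowupTowerLocalizeTransfer.lean`)

Source: V. Cossart, U. Jannsen, S. Saito, *Desingularization: Invariants and Strategy*, LNM **2270** (2020)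
[`CossartJannsenSaito2020`]: Def. 6.34 (i) / Def. 6.38 (ii) «`X_1 = Bℓ_x(X)` and `C_1 = ℙ(Dir^O_x(X))`», typed in the
tree as `BlowupTower.projDir` through `IsOnProjDirectrix π ξ` (the degree-one forms of the directrix space of `𝒪_{X,x}`
vanish at `ξ ∈ π⁻¹(x)`, `KeyTheorems.lean`), and p. 107 «the claims … depend only on the localization
`X_x = Spec(𝒪_{X,x})`». With the ring-level results of `Literature/RingTheory/HilbertSamuel/ProjDirectrixLifts.lean` /
`ProjDirectrixLiftsTransport.lean` (independence of the minimal system of generators, transport along ring isomorphisms)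
we PROVE:

* `isOnProjDirectrix_iff_of_isIso_stalkMap` — for a commutative square `ι₁ ≫ π = π' ≫ ι₀` whose horizontal maps induce
  isomorphisms of local rings at `ξ'` and at `π'(ξ')`: `ξ' ∈ ℙ(Dir_{π' ξ'})` for `π'` iff `ι₁ ξ' ∈ ℙ(Dir_{π(ι₁ ξ')})` for
  `π`;
* `BlowupTower.projDir_baseChange` — **`ℙ(Dir)` of the base-changed tower is the preimage of `ℙ(Dir)`**:
  `(T.baseChange ι₀).projDir s₀ = ι_1⁻¹ (T.projDir (ι₀ s₀))`;
* `BlowupTower.baseChange_C_one_eq_projDir` — hence Def. 6.34 (i) / 6.38 (ii) «`C_1 = ℙ(Dir_x(X))`» transfers to the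
  base-changed (in particular the localised) tower.

NOT here: `InducesIsoOn` and permissibility transfers (the remaining fields of `IsFundamentalUnit`). Nothing about
the Key Theorems is asserted. Written for the W-low bridge of cell res-hironaka [L W4.2].

## References

* V. Cossart, U. Jannsen, S. Saito, LNM 2270 (2020), Def. 2.18, Lemma 2.27, Def. 6.34 (i), Def. 6.38 (ii), p. 107.
  [CossartJannsenSaito2020]
-/

noncomputable section

open CategoryTheory CategoryTheory.Limits AlgebraicGeometry TopologicalSpace IsLocalRing
open Literature.AlgebraicGeometry.Resolution Literature.RingTheory.HilbertSamuel

namespace Literature.AlgebraicGeometry.CossartJannsenSaito2020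

universe u

/-! ## `ξ ∈ ℙ(Dir)` along a square with isomorphic local rings -/

/-- **`ξ' ∈ ℙ(Dir_{π'ξ'}(S))` iff `ι₁ ξ' ∈ ℙ(Dir_{π ι₁ ξ'}(X))`** for a commutative square `ι₁ ≫ π = π' ≫ ι₀`
(`π' : S₁ ⟶ S`, `π : X₁ ⟶ X`) in which `ι₁` induces an isomorphism of local rings at `ξ'` and `ι₀` one at `π' ξ'`
(e.g. the comparison maps of a base-changed tower of blow-ups along a flat preimmersion): the condition
`IsOnProjDirectrix` only depends on the local homomorphism `𝒪_{X,x} → 𝒪_{X₁,ξ}` up to isomorphism (CJS Def. 2.18 /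
Def. 2.26: the directrix is an invariant of `𝒪_{X,x}`; p. 107). [cite: CossartJannsenSaito2020, Def. 6.34 (i), p. 107] -/
theorem isOnProjDirectrix_iff_of_isIso_stalkMap {X₁ X S₁ S : Scheme.{u}} [IsLocallyNoetherian X]
    [IsLocallyNoetherian S] {π : X₁ ⟶ X} {π' : S₁ ⟶ S} {ι₁ : S₁ ⟶ X₁} {ι₀ : S ⟶ X}
    (hsq : ι₁ ≫ π = π' ≫ ι₀) (ξ' : S₁) [IsIso (ι₁.stalkMap ξ')] [IsIso (ι₀.stalkMap (π'.base ξ'))] :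
    IsOnProjDirectrix π' ξ' ↔ IsOnProjDirectrix π (ι₁.base ξ') := by
  -- the two base points
  have hpt : π.base (ι₁.base ξ') = ι₀.base (π'.base ξ') := by
    change (ι₁ ≫ π).base ξ' = (π' ≫ ι₀).base ξ'
    rw [hsq]
  -- the local rings and their isomorphisms
  set A := X.presheaf.stalk (π.base (ι₁.base ξ')) with hA
  set A' := S.presheaf.stalk (π'.base ξ') with hA'
  let αiso : A ≅ A' := X.presheaf.stalkCongr (.of_eq hpt) ≪≫ asIso (ι₀.stalkMap (π'.base ξ'))
  let α : A ≃+* A' := αiso.commRingCatIsoToRingEquiv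
  let β : ↑(X₁.presheaf.stalk (ι₁.base ξ')) ≃+* ↑(S₁.presheaf.stalk ξ') :=
    (asIso (ι₁.stalkMap ξ')).commRingCatIsoToRingEquiv
  -- `π'^♯ ∘ α = β ∘ π^♯`
  have key : (X.presheaf.stalkCongr (.of_eq hpt)).hom ≫ ι₀.stalkMap (π'.base ξ') ≫ π'.stalkMap ξ' =
      π.stalkMap (ι₁.base ξ') ≫ ι₁.stalkMap ξ' := by
    rw [← Scheme.Hom.stalkMap_comp π' ι₀ ξ', ← Scheme.Hom.stalkMap_comp ι₁ π ξ', Scheme.Hom.stalkMap_congr_hom _ _ hsq ξ']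
    rfl
  have hcomm : ∀ a, (π'.stalkMap ξ').hom (α a) = β ((π.stalkMap (ι₁.base ξ')).hom a) := by
    intro a
    have h := DFunLike.congr_fun (congrArg CommRingCat.Hom.hom key) a
    simp only [CommRingCat.hom_comp, RingHom.comp_apply] at h
    exact h
  -- embedding dimensions agree
  have he : (maximalIdeal A').spanFinrank = (maximalIdeal A).spanFinrank := spanFinrank_maximalIdeal_eq_of_ringEquiv α
  haveI : IsLocalHom (π'.stalkMap ξ').hom := π'.toLRSHom.prop ξ'
  -- the system `α ∘ minGenerators A`, re-indexed by `Fin (emb.dim A')`, is a minimal system of generators of `𝔪_{A'}`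
  have hgen : Ideal.span (Set.range (α ∘ minGenerators A)) = maximalIdeal A' :=
    span_range_ringEquiv_comp α (span_range_minGenerators A)
  have hsurj : Function.Surjective (Fin.cast he) := fun i => ⟨Fin.cast he.symm i, by simp⟩
  have hgen' : Ideal.span (Set.range ((α ∘ minGenerators A) ∘ Fin.cast he)) = maximalIdeal A' := by
    rw [hsurj.range_comp]
    exact hgen
  calc IsOnProjDirectrix π' ξ'
      ↔ ProjDirLiftsInto (π'.stalkMap ξ').hom (minGenerators A') (span_range_minGenerators A') := Iff.rfl
    _ ↔ ProjDirLiftsInto (π'.stalkMap ξ').hom ((α ∘ minGenerators A) ∘ Fin.cast he) hgen' :=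
        projDirLiftsInto_iff_of_minimal_of_isLocalHom _ (span_range_minGenerators A') hgen' rfl
    _ ↔ ProjDirLiftsInto (π'.stalkMap ξ').hom (α ∘ minGenerators A) hgen :=
        projDirLiftsInto_comp_cast_iff _ he hgen hgen'
    _ ↔ ProjDirLiftsInto (π.stalkMap (ι₁.base ξ')).hom (minGenerators A) (span_range_minGenerators A) :=
        projDirLiftsInto_ringEquiv_iff α β hcomm (span_range_minGenerators A)
    _ ↔ IsOnProjDirectrix π (ι₁.base ξ') := Iff.rfl

/-- **The points of `ℙ(Dir)` correspond** along such a square: `ξ' ∈ ℙ(Dir_{s}(S))` over `s` iff `ι₁ ξ' ∈ ℙ(Dir_{ι₀ s}(X))`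
over `ι₀ s`, when moreover `ι₀` is injective on points. [cite: CossartJannsenSaito2020, Def. 6.34 (i), p. 107] -/
theorem mem_projDirectrixFibre_iff_of_isIso_stalkMap {X₁ X S₁ S : Scheme.{u}} [IsLocallyNoetherian X]
    [IsLocallyNoetherian S] {π : X₁ ⟶ X} {π' : S₁ ⟶ S} {ι₁ : S₁ ⟶ X₁} {ι₀ : S ⟶ X}
    (hsq : ι₁ ≫ π = π' ≫ ι₀) (hι₀ : Function.Injective ι₀.base) (s : S) (ξ' : S₁)
    [IsIso (ι₁.stalkMap ξ')] [IsIso (ι₀.stalkMap (π'.base ξ'))] :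
    ξ' ∈ projDirectrixFibre π' s ↔ ι₁.base ξ' ∈ projDirectrixFibre π (ι₀.base s) := by
  have hpt : π.base (ι₁.base ξ') = ι₀.base (π'.base ξ') := by
    change (ι₁ ≫ π).base ξ' = (π' ≫ ι₀).base ξ'
    rw [hsq]
  rw [mem_projDirectrixFibre, mem_projDirectrixFibre, isOnProjDirectrix_iff_of_isIso_stalkMap hsq ξ', hpt]
  constructor
  · rintro ⟨h1, h2⟩
    exact ⟨by rw [h1], h2⟩
  · rintro ⟨h1, h2⟩
    exact ⟨hι₀ h1, h2⟩

/-! ## `ℙ(Dir)` on the base-changed tower -/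

namespace BlowupTower

variable (T : BlowupTower.{u}) {S₀ : Scheme.{u}} (ι₀ : S₀ ⟶ T.X 0) [Flat ι₀] [IsPreimmersion ι₀]
  [IsLocallyNoetherian S₀]

/-- **`ℙ(Dir)` of the base-changed tower is the preimage of `ℙ(Dir)`**: for `s₀ ∈ S₀`,
`(T.baseChange ι₀).projDir s₀ = ι_1⁻¹ (T.projDir (ι₀ s₀))` (Def. 6.34 (i) read on the local scheme, p. 107).
[cite: CossartJannsenSaito2020, Def. 6.34 (i), p. 107] -/
theorem projDir_baseChange (s₀ : S₀) :
    (T.baseChange ι₀).projDir s₀ = (T.bcι ι₀ 1).base ⁻¹' T.projDir (ι₀.base s₀) := by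
  haveI : IsLocallyNoetherian (T.X 0) := T.ln 0
  haveI : IsLocallyNoetherian ((T.baseChange ι₀).X 0) := (T.baseChange ι₀).ln 0
  ext ξ'
  haveI := T.isIso_stalkMap_bcι ι₀ 1 ξ'
  haveI : IsIso ((T.bcι ι₀ 0).stalkMap (((T.baseChange ι₀).π 0).base ξ')) :=
    T.isIso_stalkMap_bcι ι₀ 0 _
  exact mem_projDirectrixFibre_iff_of_isIso_stalkMap (T.bcι_comp_π ι₀ 0) (T.bcι_injective ι₀ 0) s₀ ξ'

/-- **Def. 6.34 (i) / Def. 6.38 (ii) «`C_1 = ℙ(Dir_x(X))`» transfers to the base-changed tower**: if `C_1 = ℙ(Dir_{ι₀ s₀})`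
on `T`, then `C'_1 = ℙ(Dir_{s₀})` on `T.baseChange ι₀` (e.g. on the localised tower at `x = ι₀ s₀`).
[cite: CossartJannsenSaito2020, Def. 6.34 (i), Def. 6.38 (ii), p. 107] -/
theorem baseChange_C_one_eq_projDir (s₀ : S₀) (h : T.C 1 = T.projDir (ι₀.base s₀)) :
    (T.baseChange ι₀).C 1 = (T.baseChange ι₀).projDir s₀ := by
  rw [baseChange_C, projDir_baseChange, h]

/-- The localised form: `ℙ(Dir)` of `T.localize x` over the closed point is `ι_1⁻¹ (T.projDir x)`.
[cite: CossartJannsenSaito2020, Def. 6.34 (i), p. 107] -/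
theorem projDir_localize (x : T.X 0) :
    haveI : IsLocallyNoetherian (T.X 0) := T.ln 0
    haveI := flat_fromSpecStalk (T.X 0) x
    (T.localize x).projDir (closedPoint ((T.X 0).presheaf.stalk x)) =
      (T.bcι ((T.X 0).fromSpecStalk x) 1).base ⁻¹' T.projDir x := by
  haveI : IsLocallyNoetherian (T.X 0) := T.ln 0
  haveI := flat_fromSpecStalk (T.X 0) x
  have h := T.projDir_baseChange ((T.X 0).fromSpecStalk x) (closedPoint ((T.X 0).presheaf.stalk x))
  rwa [Scheme.fromSpecStalk_closedPoint] at h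

/-- «`C_1 = ℙ(Dir_x(X))`» transfers to the localised tower at `x`. [cite: CossartJannsenSaito2020, Def. 6.38 (ii), p. 107] -/
theorem localize_C_one_eq_projDir (x : T.X 0) (h : T.C 1 = T.projDir x) :
    (T.localize x).C 1 = (T.localize x).projDir (closedPoint ((T.X 0).presheaf.stalk x)) := by
  haveI : IsLocallyNoetherian (T.X 0) := T.ln 0
  haveI := flat_fromSpecStalk (T.X 0) x
  refine T.baseChange_C_one_eq_projDir ((T.X 0).fromSpecStalk x) (closedPoint ((T.X 0).presheaf.stalk x)) ?_
  rwa [Scheme.fromSpecStalk_closedPoint]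

end BlowupTower

end Literature.AlgebraicGeometry.CossartJannsenSaito2020

end
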